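import Literature.Algebra.Homology.ContCohomologyInhomogeneousTwoCocycle
import Literature.AnabelianGeometry.AbsoluteAnabelian.FreeProSigmaCompletionBridge
import Literature.GroupTheory.CocycleCentralExtension
import HarnessLib

/-!
# `H²_cont(G, Λ) = 0` for a free profinite group `G` of finite rank ([AbsTopI] Lem. 4.5 (i) "free pro-`Σ`", `Σ` = all primes)

S. Mochizuki, *Topics in Absolute Anabelian Geometry I* [AbsTopI] (lit key `paper:url-11ac98ba15fc`),
Lemma 4.5 (i) p. 54 supplies the vocabulary: abc-iut-L4-t4's predicate `IsFreeProOn G Σ gens` / `IsFreePro G Σ`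
(`AbsTopISemiAbsolute.lean`) — "free pro-`Σ` of finite rank" by the universal property into finite
`Σ`-groups.  Print USES of the freeness of `Δ_U` for an AFFINE hyperbolic curve `U` ([AbsTopI] Lem. 4.5 (i);
[AbsTopIII] Prop. 1.4 (ii), where the differential `Hom(I_x, Λ) → H²(Δ_X, Λ)` of
`1 → I_x → Δ^{c-cn}_{U_x} → Δ_X → 1` is surjective BECAUSE `H²(Δ_{U_x}, Λ) = 0`) go through the classical
fact that a free profinite group has cohomological dimension `≤ 1`, i.e. is PROJECTIVE (Gruenberg 1967;
Ribes–Zalesskii, *Profinite Groups*, §7.6; Serre, *Cohomologie galoisienne*, I §5.9 Prop. 45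
[cite: SerreGaloisCohomology1997, I §5.9]).  This proof-only file (no definitions, no named facts) proves
it IN THE TREE'S CONTINUOUS COHOMOLOGY (Mathlib's `continuousCohomology`, homogeneous continuous cochains,
trivial coefficients):

* `IsFreeProOn.exists_continuous_splitting` — for `G` profinite and free profinite on `gens : Fin n → G`
  and `Λ` a compact totally disconnected abelian group, every jointly continuous normalized inhomogeneous
  `2`-cocycle `c : G × G → Λ` is `β(gh) − β(g) − β(h)` for a CONTINUOUS `β` — the twisted product
  `G ×_c Λ` (the tree's `Literature.GroupTheory.TwistedProduct`, HodgeCM cell) topologised as `G × Λ` is a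
  profinite group, and the generator assignment `xᵢ ↦ (gens i, 0)` extends along the pro-(all primes)
  completion `F_n → G` (`IsFreeProOn.isProSigmaCompletion_lift`, abc-iut-L4-t15) to a continuous
  homomorphic section of `G ×_c Λ ↠ G` (`IsProSigmaCompletion.exists_continuous_extend_profinite`,
  abc-iut-L3; uniqueness `continuous_extend_profinite_unique` gives `fst ∘ Φ = id`);
* `IsFreeProOn.π_two_eq_zero`, `IsFreeProOn.subsingleton_continuousCohomology_two`,
  `IsFreePro.subsingleton_continuousCohomology_two` — **every class of `H²_cont(G, Λ)` vanishes**
  (`ContinuousCohomology.π_two_eq_zero_of_forall_inhomogeneous`, the inhomogeneous criterion of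
  `Algebra/Homology/ContCohomologyInhomogeneousTwoCocycle.lean`).

Consumer: `AbsTopIII/CcnTransgressionFreeGeom.lean` replaces the structural input
`Subsingleton (geomH2 (M.ext U_x) Ẑ)` of abc-iut-f-076's `CurveModel.prop_1_4_ii_transgression_of_instanceClass`
(FACT-LIST F-0338 at the instance class) by `IsFreePro Δ_{U_x} Set.univ`.
HONEST FRAMING: classical profinite group theory (refereed, undisputed); nothing here bears on [IUTchIII]
Cor. 3.12; typed ≠ proved elsewhere.
-/

noncomputable section

open CategoryTheory TopRep ContRepresentation Topology

/-! ### Free profinite groups of finite rank: continuous `2`-cocycles split, `H² = 0` -/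

namespace Literature.AnabelianGeometry.AbsoluteAnabelian

open Literature.AnabelianGeometry.SemiGraphs.SemiGraphOfAnabelioids (IsProSigmaCompletion)
open Literature.AnabelianGeometry.Anabelioids (IsSigmaInteger)
open Literature.GroupTheory

universe u

variable {G : Type u} [Group G] [TopologicalSpace G] [IsTopologicalGroup G]
  [CompactSpace G] [T2Space G] [TotallyDisconnectedSpace G] {n : ℕ} {gens : Fin n → G}
  {Λ : Type u} [AddCommGroup Λ] [TopologicalSpace Λ] [IsTopologicalAddGroup Λ]
  [CompactSpace Λ] [TotallyDisconnectedSpace Λ]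

/-- **Continuous normalized `2`-cocycles on a free profinite group of finite rank split continuously.**
Let `G` be a profinite group, free profinite on `gens : Fin n → G` (`IsFreeProOn G Set.univ gens`), and
`Λ` a compact totally disconnected abelian coefficient group (e.g. `Ẑ`, `ℤ_p`, a finite group).  Then
every jointly continuous `c : G × G → Λ` with `c(g,h) + c(gh,l) = c(g,hl) + c(h,l)` and `c(1,1) = 0` is
of the form `c(g,h) = β(gh) − β(g) − β(h)` for a CONTINUOUS `β : G → Λ`.  Proof: the twisted product
`G ×_c Λ` (the tree's `Literature.GroupTheory.TwistedProduct`, law `(g,a)(h,b) = (gh, a + b + c(g,h))`),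
topologised as `G × Λ`, is a profinite group and `G ×_c Λ → G` is a continuous surjective
homomorphism; since `G` is the pro-(all primes) completion of the free group on `gens`
(`IsFreeProOn.isProSigmaCompletion_lift`), the assignment `xᵢ ↦ (gens i, 0)` extends to a continuous
homomorphism `Φ : G → G ×_c Λ` (`IsProSigmaCompletion.exists_continuous_extend_profinite`) with
`fst ∘ Φ = id` (uniqueness of continuous extensions), and `β := snd ∘ Φ` splits `c`
("a free profinite group is projective": Gruenberg, *Projective profinite groups*, J. London Math.
Soc. 42 (1967); Ribes–Zalesskii, *Profinite Groups*, §7.6; the lifting property characterises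
cohomological dimension `≤ 1`, Serre I §5.9 Prop. 45). [cite: SerreGaloisCohomology1997, I §5.9] -/
theorem IsFreeProOn.exists_continuous_splitting (hG : IsFreeProOn G Set.univ gens)
    (c : G → G → Λ) (hc : Continuous fun p : G × G => c p.1 p.2)
    (hcoc : ∀ g h l, c g h + c (g * h) l = c g (h * l) + c h l) (h11 : c 1 1 = 0) :
    ∃ β : C(G, Λ), ∀ g h, c g h = β (g * h) - β g - β h := by
  classical
  -- the bundled (multiplicatively written) normalized cocycle
  let cm : CentralCocycle G (Multiplicative Λ) :=
    { toFun := fun g h => Multiplicative.ofAdd (c g h)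
      cocycle' := fun g h l => by
        change Multiplicative.ofAdd (c g h) * Multiplicative.ofAdd (c (g * h) l) =
          Multiplicative.ofAdd (c g (h * l)) * Multiplicative.ofAdd (c h l)
        rw [← ofAdd_add, ← ofAdd_add, hcoc]
      map_one_one' := by
        change Multiplicative.ofAdd (c 1 1) = 1
        rw [h11, ofAdd_zero] }
  have hcm : ∀ g h, Multiplicative.toAdd (cm g h) = c g h := fun _ _ => rfl
  -- the twisted product `G ×_c Λ`, topologised through the bijection with `G × Λ`
  let e : TwistedProduct cm ≃ G × Λ :=
    { toFun := fun x => (x.g, Multiplicative.toAdd x.a)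
      invFun := fun p => ⟨p.1, Multiplicative.ofAdd p.2⟩
      left_inv := fun _ => rfl
      right_inv := fun _ => rfl }
  letI : TopologicalSpace (TwistedProduct cm) := TopologicalSpace.induced e inferInstance
  have he : IsInducing e := ⟨rfl⟩
  have hec : Continuous e := he.continuous
  let eₜ : TwistedProduct cm ≃ₜ G × Λ := e.toHomeomorphOfIsInducing he
  have hg : Continuous fun x : TwistedProduct cm => x.g := continuous_fst.comp hec
  have ha : Continuous fun x : TwistedProduct cm => Multiplicative.toAdd x.a :=
    continuous_snd.comp hec
  haveI : CompactSpace (TwistedProduct cm) := eₜ.symm.compactSpace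
  haveI : TotallyDisconnectedSpace (TwistedProduct cm) := eₜ.symm.totallyDisconnectedSpace
  haveI : IsTopologicalGroup (TwistedProduct cm) :=
    { continuous_mul := by
        refine he.continuous_iff.mpr ?_
        change Continuous fun p : TwistedProduct cm × TwistedProduct cm =>
          (p.1.g * p.2.g, Multiplicative.toAdd p.1.a + Multiplicative.toAdd p.2.a + c p.1.g p.2.g)
        exact ((hg.comp continuous_fst).mul (hg.comp continuous_snd)).prodMk
          (((ha.comp continuous_fst).add (ha.comp continuous_snd)).add
            (hc.comp ((hg.comp continuous_fst).prodMk (hg.comp continuous_snd))))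
      continuous_inv := by
        refine he.continuous_iff.mpr ?_
        change Continuous fun x : TwistedProduct cm =>
          (x.g⁻¹, -Multiplicative.toAdd x.a + -c x.g⁻¹ x.g)
        exact hg.inv.prodMk (ha.neg.add (hc.comp (hg.inv.prodMk hg)).neg) }
  -- open (normal) subgroups of the compact group `G ×_c Λ` have finite, `Set.univ`-integer index
  have hB : ∀ V : Subgroup (TwistedProduct cm), V.Normal → IsOpen (V : Set (TwistedProduct cm)) →
      IsSigmaInteger Set.univ V.index := by
    intro V _ hVo
    haveI : Finite (TwistedProduct cm ⧸ V) := Subgroup.quotient_finite_of_isOpen V hVo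
    haveI : V.FiniteIndex := Subgroup.finiteIndex_of_finite_quotient
    exact ⟨Nat.pos_of_ne_zero Subgroup.FiniteIndex.index_ne_zero, fun q _ _ => Set.mem_univ q⟩
  -- `G` is the pro-`univ` completion of the free group on `gens`; extend `xᵢ ↦ (gens i, 0)`
  have hι : IsProSigmaCompletion Set.univ (FreeGroup.lift gens) := hG.isProSigmaCompletion_lift
  let f : FreeGroup (Fin n) →* TwistedProduct cm :=
    FreeGroup.lift fun i => TwistedProduct.sec cm (gens i)
  obtain ⟨Φ, hΦc, hΦι⟩ := hι.exists_continuous_extend_profinite hB f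
  -- `fst ∘ Φ = id`: both are continuous homomorphisms extending `xᵢ ↦ gens i`
  have hfst : (TwistedProduct.fst cm).comp Φ = MonoidHom.id G := by
    refine hι.continuous_extend_profinite_unique (hg.comp hΦc) continuous_id fun γ => ?_
    rw [MonoidHom.comp_apply, hΦι, MonoidHom.id_apply, ← MonoidHom.comp_apply]
    congr 1
    refine FreeGroup.ext_hom _ _ fun i => ?_
    rw [MonoidHom.comp_apply]
    change TwistedProduct.fst cm (FreeGroup.lift (fun i => TwistedProduct.sec cm (gens i))
      (FreeGroup.of i)) = FreeGroup.lift gens (FreeGroup.of i)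
    rw [FreeGroup.lift_apply_of, FreeGroup.lift_apply_of]
    rfl
  have hfst' : ∀ g, (Φ g).g = g := fun g => DFunLike.congr_fun hfst g
  -- the `Λ`-coordinate of `Φ` is the continuous splitting function
  refine ⟨⟨fun g => Multiplicative.toAdd (Φ g).a, ha.comp hΦc⟩, fun g h => ?_⟩
  have hm := congrArg (fun x : TwistedProduct cm => Multiplicative.toAdd x.a) (map_mul Φ g h)
  change Multiplicative.toAdd (Φ (g * h)).a =
    Multiplicative.toAdd (Φ g).a + Multiplicative.toAdd (Φ h).a + c (Φ g).g (Φ h).g at hm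
  rw [hfst', hfst'] at hm
  change c g h = Multiplicative.toAdd (Φ (g * h)).a - Multiplicative.toAdd (Φ g).a -
    Multiplicative.toAdd (Φ h).a
  rw [hm]
  abel

/-- **`H²_cont(G, Λ) = 0` for a free profinite group `G` of finite rank**: every class of Mathlib's
continuous cohomology `H²(G, Λ)` (homogeneous continuous cochains, trivial coefficients `Λ` compact and
totally disconnected) vanishes — cohomological dimension `≤ 1` of free profinite groups, in the tree's
`IsFreeProOn` vocabulary ([AbsTopI] Lem. 4.5 (i) "free pro-`Σ`", `Σ` = all primes).
[cite: SerreGaloisCohomology1997, I §5.9] -/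
theorem IsFreeProOn.π_two_eq_zero (hG : IsFreeProOn G Set.univ gens)
    (z : (homogeneousCochains (ContinuousCohomology.trivCoeff G Λ)).cycles 2) :
    ((homogeneousCochains (ContinuousCohomology.trivCoeff G Λ)).homologyπ 2).hom z = 0 :=
  ContinuousCohomology.π_two_eq_zero_of_forall_inhomogeneous
    (fun c hc hcoc h11 => hG.exists_continuous_splitting c hc hcoc h11) z

/-- **`H²_cont(G, Λ)` is trivial for a free profinite group `G` of finite rank** (`Subsingleton` form of
`IsFreeProOn.π_two_eq_zero`: every class is represented by a cocycle).
[cite: SerreGaloisCohomology1997, I §5.9] -/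
theorem IsFreeProOn.subsingleton_continuousCohomology_two (hG : IsFreeProOn G Set.univ gens) :
    Subsingleton (continuousCohomology 2 (ContinuousCohomology.trivCoeff G Λ)) := by
  refine ⟨fun ξ η => ?_⟩
  obtain ⟨z, rfl⟩ :=
    ContinuousCohomology.homologyπ_two_surjective (ContinuousCohomology.trivCoeff G Λ) ξ
  obtain ⟨z', rfl⟩ :=
    ContinuousCohomology.homologyπ_two_surjective (ContinuousCohomology.trivCoeff G Λ) η
  rw [hG.π_two_eq_zero z, hG.π_two_eq_zero z']

/-- The same for a free profinite group of SOME finite rank (`IsFreePro G Set.univ`).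
[cite: SerreGaloisCohomology1997, I §5.9] -/
theorem IsFreePro.subsingleton_continuousCohomology_two (hG : IsFreePro G Set.univ) :
    Subsingleton (continuousCohomology 2 (ContinuousCohomology.trivCoeff G Λ)) := by
  obtain ⟨_, _, h⟩ := hG
  exact h.subsingleton_continuousCohomology_two

/-! ### Appendix (append-only): any `Σ` containing all primes

The tree's genuine inhabitants are stated with `Σ = {p | p.Prime}` (`isFreePro_profiniteCompletion_freeGroup`,
`FreeProSigmaNonVacuity.lean`) rather than `Σ = Set.univ`; for a `Σ` containing every prime the predicates
`IsFreeProOn G Σ gens` / `IsFreePro G Σ` agree with the `Set.univ` ones (the pro-`Σ` clause and the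
`Σ`-condition on the finite test groups are then vacuous), so the vanishing of `H²` is restated for such `Σ`. -/

omit [IsTopologicalGroup G] [CompactSpace G] [T2Space G] [TotallyDisconnectedSpace G] in
/-- For `Σ ⊇ {primes}`, free pro-`Σ` on `gens` means free PROFINITE on `gens` (`Σ = Set.univ`): the
pro-`Σ` clause and the `Σ`-restriction on the finite test groups are vacuous.
[cite: MochizukiAbsTopI2012, Lemma 4.5 (i) p.54] -/
theorem IsFreeProOn.univ_of_primes_subset {S : Set ℕ} (hS : ∀ p : ℕ, p.Prime → p ∈ S)
    (h : IsFreeProOn G S gens) : IsFreeProOn G Set.univ gens :=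
  ⟨⟨fun _ _ _ q _ _ => Set.mem_univ q⟩,
    fun K _ _ _ _ _ f => h.2 K (fun q hq _ => hS q hq) f⟩

omit [IsTopologicalGroup G] [CompactSpace G] [T2Space G] [TotallyDisconnectedSpace G] in
/-- Conversely free profinite on `gens` is free pro-`Σ` on `gens` for every `Σ ⊇ {primes}`.
[cite: MochizukiAbsTopI2012, Lemma 4.5 (i) p.54] -/
theorem IsFreeProOn.of_univ_of_primes_subset {S : Set ℕ} (hS : ∀ p : ℕ, p.Prime → p ∈ S)
    (h : IsFreeProOn G Set.univ gens) : IsFreeProOn G S gens :=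
  ⟨⟨fun _ _ _ q hq _ => hS q hq⟩, fun K _ _ _ _ _ f => h.2 K (fun q _ _ => Set.mem_univ q) f⟩

omit [IsTopologicalGroup G] [CompactSpace G] [T2Space G] [TotallyDisconnectedSpace G] in
/-- `IsFreePro G Σ → IsFreePro G Set.univ` for `Σ ⊇ {primes}`. [cite: MochizukiAbsTopI2012, Lemma 4.5 (i) p.54] -/
theorem IsFreePro.univ_of_primes_subset {S : Set ℕ} (hS : ∀ p : ℕ, p.Prime → p ∈ S)
    (h : IsFreePro G S) : IsFreePro G Set.univ := by
  obtain ⟨n, gens, h⟩ := h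
  exact ⟨n, gens, h.univ_of_primes_subset hS⟩

/-- **`H²_cont(G, Λ) = 0` for `G` free pro-`Σ` of finite rank on `gens`, `Σ ⊇ {primes}`** (e.g. the
tree's `Σ = {p | p.Prime}`). [cite: SerreGaloisCohomology1997, I §5.9] -/
theorem IsFreeProOn.π_two_eq_zero_of_primes_subset {S : Set ℕ} (hS : ∀ p : ℕ, p.Prime → p ∈ S)
    (hG : IsFreeProOn G S gens)
    (z : (homogeneousCochains (ContinuousCohomology.trivCoeff G Λ)).cycles 2) :
    ((homogeneousCochains (ContinuousCohomology.trivCoeff G Λ)).homologyπ 2).hom z = 0 :=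
  (hG.univ_of_primes_subset hS).π_two_eq_zero z

/-- **`H²_cont(G, Λ)` is trivial for `G` free pro-`Σ` of some finite rank, `Σ ⊇ {primes}`** — the form
consumed with the tree's inhabitants `isFreePro_profiniteCompletion_freeGroup n : IsFreePro F̂_n {p | p.Prime}`.
[cite: SerreGaloisCohomology1997, I §5.9] -/
theorem IsFreePro.subsingleton_continuousCohomology_two_of_primes_subset {S : Set ℕ}
    (hS : ∀ p : ℕ, p.Prime → p ∈ S) (hG : IsFreePro G S) :
    Subsingleton (continuousCohomology 2 (ContinuousCohomology.trivCoeff G Λ)) :=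
  (hG.univ_of_primes_subset hS).subsingleton_continuousCohomology_two

end Literature.AnabelianGeometry.AbsoluteAnabelian
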